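import Summits.NavierStokesRegularity.FluidComputer.AngularGalerkinLadderAdjoint
import Summits.NavierStokesRegularity.FluidComputer.AngularGalerkinLadderRadialCutoff
import Summits.NavierStokesRegularity.FluidComputer.AngularGalerkinLadderRotation
import HarnessLib

/-!
# Rung `0` of the angular Galerkin ladder is never singular (route `AngularGalerkinLadder`, K1)

Negative-lane small-model fact for `stmt-NavierStokesRegularity-19959` (`RungBlowupCofinal`,
crux K1 of route №8 `AngularGalerkinLadder`: `∀ L₀, ∃ L ≥ L₀, RungIsSingular L`), cell ns-blowup,
refuter5 (K5-40).  No route file is imported; nothing here asserts a Theses declaration.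

* `eq_zero_of_isBandLimited_zero_of_isDivFree` — a smooth divergence-free field on `ℝ³` that is
  band-limited of degree `0` about the origin (`𝒞w = 0`, the `SO(3)`-invariant isotype) is `0`.
  Proof in the kernel: a radial bump cut-off reduces to the compactly supported statement
  `angGen_eq_zero_of_isBandLimited_zero` (all three generators vanish pointwise); the generator about
  the axis through `x` gives `x × w(x) = 0`, i.e. `‖x‖² w(x) = ⟪w(x), x⟫ x`; comparing the divergences
  of the two sides (`div w = 0`) gives the radial ODE `Dg(x) x = −g(x)` for `g(x) = ⟪w(x), x⟫`, so
  `r ↦ r g(r x)` is constant and `g ≡ 0`; at the origin `e_a × w(0) = 0` for the three axes.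
* `rung_zero_slice_eq_zero` — every slice of a rung-`0` solution (`IsRungSolutionOn S ν 0 u p d`,
  any time set, any viscosity) is the zero field.  Consequently EVERY forward or ancient rung stub
  instantiated at `L = 0` that asks for a non-zero / unbounded slice is uninhabited.
* `rungIsSingular_zero_false : ¬ RungIsSingular 0` and `rungIsSingular_pos` — the cofinal quantifier
  of K1 is never witnessed at `L = 0` (the docstring remark «rung 0 false on paper» of the planner's
  birth skeleton v4, now a kernel fact).

READING (refuter, information — not a verdict on any item): K1 is a statement about LARGE rungs; this
file only pins the bottom of the ladder.  Rung `1` (isotypes `≤ 1`: differential rotations `T₁ₘ` and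
the dipole fields `P₁ₘ`) is not settled here.
-/

namespace Summit.NavierStokesRegularity.RungBlowupCofinalRungZeroNotSingular

open Set MeasureTheory Filter Topology Function
open scoped ContDiff RealInnerProductSpace
open Literature.Analysis.FluidPDE
open Summit.NavierStokesRegularity.FluidComputer
open Summit.NavierStokesRegularity.FluidComputer.AngularLadder

variable {w : EuclideanSpace ℝ (Fin 3) → EuclideanSpace ℝ (Fin 3)}

/-- Step 1: for a field band-limited of degree `0` every rotation generator vanishes POINTWISE
(no support hypothesis): cut `w` off radially by a bump equal to `1` near `‖x‖²`, apply the compactly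
supported statement `angGen_eq_zero_of_isBandLimited_zero`, and use that radial multipliers commute
with the generators. [folklore] -/
theorem angGen_apply_eq_zero (h0 : IsBandLimited 0 w) (a : Fin 3) (x : EuclideanSpace ℝ (Fin 3)) :
    angGen a w x = 0 := by
  let b : ContDiffBump (‖x‖ ^ 2 : ℝ) := ⟨1, 2, one_pos, one_lt_two⟩
  have hχs : ContDiff ℝ ∞ (b : ℝ → ℝ) := b.contDiff
  have hχc : HasCompactSupport (b : ℝ → ℝ) := b.hasCompactSupport
  have hχ1 : (b : ℝ → ℝ) (‖x‖ ^ 2) = 1 :=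
    b.one_of_mem_closedBall (Metric.mem_closedBall_self one_pos.le)
  have hb : IsBandLimited 0 (fun y => (b : ℝ → ℝ) (‖y‖ ^ 2) • w y) := h0.radial_smul hχs
  have hcs : HasCompactSupport (fun y : EuclideanSpace ℝ (Fin 3) => (b : ℝ → ℝ) (‖y‖ ^ 2) • w y) :=
    hasCompactSupport_radial_smul hχc w
  have hz := angGen_eq_zero_of_isBandLimited_zero hb hcs a
  rw [angGen_radial_smul (hχs.differentiable (by simp)) (h0.1.differentiable (by simp))] at hz
  have hx := congrFun hz x
  simpa [hχ1] using hx

/-- Step 2: `x × w(x) = 0` — the generator about the axis through `x` is `Σ xᵢ Jᵢ`, whose transport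
term `Dw(x)(x × x)` vanishes. [folklore] -/
theorem cross_self_apply_eq_zero (h0 : IsBandLimited 0 w) (x : EuclideanSpace ℝ (Fin 3)) :
    cross x (w x) = 0 := by
  have h := sum_smul_angGen w x x
  have hxx : cross x x = 0 := by simp [cross]
  simp only [angGen_apply_eq_zero h0, smul_zero, Finset.sum_const_zero, hxx, map_zero,
    sub_zero] at h
  exact h.symm

/-- Step 3: `‖x‖² w(x) = ⟪w(x), x⟫ x` (vector triple product form of `x × w(x) = 0`). [folklore] -/
theorem norm_sq_smul_eq (h0 : IsBandLimited 0 w) (x : EuclideanSpace ℝ (Fin 3)) :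
    ‖x‖ ^ 2 • w x = ⟪w x, x⟫ • x := by
  have hc := cross_self_apply_eq_zero h0 x
  have e : ∀ i, cross x (w x) i = 0 := fun i => by rw [hc]; rfl
  have e0 := e 0
  have e1 := e 1
  have e2 := e 2
  simp only [cross, cross_apply, PiLp.toLp_apply, Matrix.cons_val_zero,
    Matrix.cons_val_one, Matrix.cons_val_two, Matrix.head_cons, Matrix.tail_cons] at e0 e1 e2
  rw [EuclideanSpace.real_norm_sq_eq x]
  ext j
  simp only [PiLp.smul_apply, smul_eq_mul, PiLp.inner_apply, RCLike.inner_apply, conj_trivial,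
    Fin.sum_univ_three]
  fin_cases j <;> simp only [Fin.isValue, Fin.zero_eta, Fin.mk_one, Fin.reduceFinMk]
  · linear_combination (-(x.ofLp 1)) * e2 + (x.ofLp 2) * e1
  · linear_combination (x.ofLp 0) * e2 - (x.ofLp 2) * e0
  · linear_combination (x.ofLp 1) * e0 - (x.ofLp 0) * e1

/-- Step 4a: `div (‖·‖² w)(x) = ‖x‖² div w(x) + 2⟪x, w(x)⟫`. [folklore] -/
theorem divergence_norm_sq_smul (hw : Differentiable ℝ w) (x : EuclideanSpace ℝ (Fin 3)) :
    VectorCalculus.divergence (fun y : EuclideanSpace ℝ (Fin 3) => ‖y‖ ^ 2 • w y) x =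
      ‖x‖ ^ 2 * VectorCalculus.divergence w x + 2 * ⟪x, w x⟫ := by
  have hd : HasFDerivAt (fun y : EuclideanSpace ℝ (Fin 3) => ‖y‖ ^ 2 • w y)
      (‖x‖ ^ 2 • fderiv ℝ w x + ((2 : ℕ) • innerSL ℝ x).smulRight (w x)) x :=
    (hasStrictFDerivAt_norm_sq x).hasFDerivAt.smul (hw x).hasFDerivAt
  rw [divergence_eq_sum_inner_fderiv (EuclideanSpace.basisFun (Fin 3) ℝ),
    divergence_eq_sum_inner_fderiv (EuclideanSpace.basisFun (Fin 3) ℝ) w, hd.fderiv]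
  simp only [_root_.add_apply, _root_.smul_apply,
    ContinuousLinearMap.smulRight_apply, inner_add_right, inner_smul_right, Finset.sum_add_distrib,
    ← Finset.mul_sum]
  congr 1
  rw [← (EuclideanSpace.basisFun (Fin 3) ℝ).sum_inner_mul_inner x (w x), Finset.mul_sum]
  refine Finset.sum_congr rfl fun i _ => ?_
  rw [nsmul_eq_mul, Nat.cast_ofNat]
  simp only [innerSL_apply_apply]
  ring

/-- Step 4b: `div (g · id)(x) = 3 g(x) + Dg(x) x` for a differentiable scalar `g`. [folklore] -/
theorem divergence_smul_id {g : EuclideanSpace ℝ (Fin 3) → ℝ} (hg : Differentiable ℝ g)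
    (x : EuclideanSpace ℝ (Fin 3)) :
    VectorCalculus.divergence (fun y : EuclideanSpace ℝ (Fin 3) => g y • y) x =
      3 * g x + fderiv ℝ g x x := by
  have hd : HasFDerivAt (fun y : EuclideanSpace ℝ (Fin 3) => g y • y)
      (g x • ContinuousLinearMap.id ℝ (EuclideanSpace ℝ (Fin 3)) + (fderiv ℝ g x).smulRight x) x :=
    (hg x).hasFDerivAt.smul (hasFDerivAt_id x)
  rw [divergence_eq_sum_inner_fderiv (EuclideanSpace.basisFun (Fin 3) ℝ), hd.fderiv]
  simp only [_root_.add_apply, _root_.smul_apply,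
    ContinuousLinearMap.smulRight_apply, ContinuousLinearMap.id_apply, inner_add_right,
    inner_smul_right, Finset.sum_add_distrib, real_inner_self_eq_norm_sq,
    (EuclideanSpace.basisFun (Fin 3) ℝ).orthonormal.1, one_pow, mul_one, Finset.sum_const,
    Finset.card_univ, Fintype.card_fin, nsmul_eq_mul, Nat.cast_ofNat]
  congr 1
  have hr := (EuclideanSpace.basisFun (Fin 3) ℝ).sum_repr' x
  calc ∑ i, fderiv ℝ g x ((EuclideanSpace.basisFun (Fin 3) ℝ) i) * ⟪(EuclideanSpace.basisFun (Fin 3) ℝ) i, x⟫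
      = fderiv ℝ g x (∑ i, ⟪(EuclideanSpace.basisFun (Fin 3) ℝ) i, x⟫ • (EuclideanSpace.basisFun (Fin 3) ℝ) i) := by
        rw [map_sum]; exact Finset.sum_congr rfl fun i _ => by rw [map_smul, smul_eq_mul, mul_comm]
    _ = fderiv ℝ g x x := by rw [hr]

/-- Step 5: the radial ODE. For `w` band-limited of degree `0` and divergence free,
`g(x) = ⟪w(x), x⟫` satisfies `Dg(x) x = −g(x)`, hence `r ↦ r g(r x)` is constant, so `g ≡ 0`.
[folklore] -/
theorem inner_self_apply_eq_zero (h0 : IsBandLimited 0 w) (hdiv : VectorCalculus.IsDivFree w)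
    (x : EuclideanSpace ℝ (Fin 3)) : ⟪w x, x⟫ = 0 := by
  have hw : Differentiable ℝ w := h0.1.differentiable (by simp)
  set g : EuclideanSpace ℝ (Fin 3) → ℝ := fun y => ⟪w y, y⟫ with hgdef
  have hg : Differentiable ℝ g := hw.inner ℝ differentiable_id
  have hfun : (fun y : EuclideanSpace ℝ (Fin 3) => ‖y‖ ^ 2 • w y) = fun y => g y • y :=
    funext (norm_sq_smul_eq h0)
  -- (E1): Dg(z) z = -g z for every z
  have hE : ∀ z : EuclideanSpace ℝ (Fin 3), fderiv ℝ g z z = -g z := by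
    intro z
    have h1 := divergence_norm_sq_smul hw z
    rw [hfun, divergence_smul_id hg z, hdiv z, mul_zero, zero_add] at h1
    have : g z = ⟪z, w z⟫ := real_inner_comm _ _
    linarith
  -- k(r) = r * g (r • x) is constant
  set k : ℝ → ℝ := fun r => r * g (r • x) with hkdef
  have hkd : ∀ r, HasDerivAt k 0 r := by
    intro r
    have h1 : HasDerivAt (fun r : ℝ => r • x) ((1 : ℝ) • x) r := (hasDerivAt_id r).smul_const x
    rw [one_smul] at h1
    have h2 : HasDerivAt (fun r : ℝ => g (r • x)) (fderiv ℝ g (r • x) x) r := by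
      have := ((hg (r • x)).hasFDerivAt).comp_hasDerivAt r h1
      simpa [Function.comp_def] using this
    have h3 : HasDerivAt (fun y : ℝ => y * g (y • x)) (1 * g (r • x) + r * fderiv ℝ g (r • x) x) r :=
      (hasDerivAt_id' r).mul h2
    have h4 : r * fderiv ℝ g (r • x) x = -g (r • x) := by
      have := hE (r • x)
      rw [map_smul, smul_eq_mul] at this
      exact this
    exact h3.congr_deriv (by rw [h4]; ring)
  have hk : k 1 = k 0 := is_const_of_deriv_eq_zero (fun r => (hkd r).differentiableAt)
    (fun r => (hkd r).deriv) 1 0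
  simpa [hkdef] using hk


/-- **The only smooth divergence-free field on `ℝ³` that is band-limited of degree `0`
(i.e. `SO(3)`-invariant, `𝒞w = 0`) is `w = 0`.** Off the origin `‖x‖² w(x) = ⟪w(x), x⟫ x = 0`;
at the origin `J_a w(0) = e_a × w(0) = 0` for the three axes. (On paper: an invariant field is
`f(r) x`, and `div = 3f + r f′ = 0` forces `f = c r⁻³`, smooth only for `c = 0`.) [folklore] -/
theorem eq_zero_of_isBandLimited_zero_of_isDivFree (h0 : IsBandLimited 0 w)
    (hdiv : VectorCalculus.IsDivFree w) : w = 0 := by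
  funext x
  by_cases hx : x = 0
  · subst hx
    have h : ∀ a, cross (axis a) (w 0) = 0 := by
      intro a
      have h1 := angGen_apply_eq_zero h0 a 0
      have hc0 : cross (axis a) (0 : EuclideanSpace ℝ (Fin 3)) = 0 := by simp [cross]
      simpa [angGen, hc0] using h1
    have e : ∀ a i, cross (axis a) (w 0) i = 0 := fun a i => by rw [h a]; rfl
    have e01 := e 0 1
    have e02 := e 0 2
    have e12 := e 1 2
    simp only [cross, cross_apply, axis, EuclideanSpace.single, PiLp.toLp_apply,
      Matrix.cons_val_zero, Matrix.cons_val_one, Matrix.cons_val_two, Matrix.head_cons,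
      Matrix.tail_cons, Fin.isValue] at e01 e02 e12
    ext i
    fin_cases i <;> simp only [Fin.isValue, Fin.zero_eta, Fin.mk_one, Fin.reduceFinMk]
    · simpa using e12
    · simpa using e02
    · simpa using e01
  · have h3 := norm_sq_smul_eq h0 x
    rw [inner_self_apply_eq_zero h0 hdiv x, zero_smul] at h3
    have hn : ‖x‖ ^ 2 ≠ 0 := pow_ne_zero 2 (norm_ne_zero_iff.mpr hx)
    exact (smul_eq_zero.mp h3).resolve_left hn

/-- **Every slice of a rung-`0` solution vanishes** (any time set, any viscosity): the slice is
band-limited of degree `0` and divergence free. [folklore] -/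
theorem rung_zero_slice_eq_zero {S : Set ℝ} {ν : ℝ}
    {u : ℝ → EuclideanSpace ℝ (Fin 3) → EuclideanSpace ℝ (Fin 3)}
    {p : ℝ → EuclideanSpace ℝ (Fin 3) → ℝ} {d : ℝ → EuclideanSpace ℝ (Fin 3) → EuclideanSpace ℝ (Fin 3)}
    (h : IsRungSolutionOn S ν 0 u p d) {t : ℝ} (ht : t ∈ S) : u t = 0 :=
  eq_zero_of_isBandLimited_zero_of_isDivFree (h.2.1 t ht) (h.1.divFree t ht)

/-- **Rung `0` of the angular Galerkin ladder is never singular**: `¬ RungIsSingular 0` — a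
nontrivial Type-I rotated-DSS ancient rung-`0` profile cannot exist because every rung-`0` slice is
the zero field. The cofinal quantifier of K1 (`RungBlowupCofinal = ∀ L₀, ∃ L ≥ L₀, RungIsSingular L`)
is therefore never witnessed at `L = 0`. [folklore] -/
theorem rungIsSingular_zero_false : ¬ RungIsSingular 0 := by
  rintro ⟨C₀, c, R, u, p, d, ⟨hsol, -, -, -⟩, t, ht, x, hx⟩
  exact hx (by rw [rung_zero_slice_eq_zero hsol (Set.mem_Iio.mpr ht)]; rfl)

/-- Every singular rung is positive. [folklore] -/
theorem rungIsSingular_pos {L : ℕ} (h : RungIsSingular L) : 0 < L := by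
  rcases Nat.eq_zero_or_pos L with rfl | hL
  · exact absurd h rungIsSingular_zero_false
  · exact hL

end Summit.NavierStokesRegularity.RungBlowupCofinalRungZeroNotSingular
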